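import Literature.Topology.FourManifolds.NullImages
import Mathlib.Analysis.SpecialFunctions.Trigonometric.Deriv
import Mathlib.MeasureTheory.Measure.Haar.OfBasis
import Mathlib.MeasureTheory.Constructions.BorelSpace.Basic
import Mathlib.LinearAlgebra.Determinant
import Mathlib.Topology.Algebra.Module.FiniteDimension
import HarnessLib

/-!
# Generic first-harmonic perturbations of a plane curve are in general position

Topic `Literature/Topology/FourManifolds`; the measure-theoretic heart of the proof of the named
fact `Literature.Topology.FourManifolds.Knot.exists_hasGaussDiagram_of_isIsotopic`
(`GaussDiagrams.lean`: every knot is isotopic to one whose stereographic plane curve is a generic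
immersion; Reidemeister, *Knotentheorie* (1932), Kap. I §1; Cromwell, *Knots and Links* (2004),
Thm. 3.2.1). Everything here is proved; no named facts; no knots appear — this file is plane
calculus and Lebesgue measure.

Let `γ : ℝ → ℝ²` be `C^∞` (`ℝ² = ℝ × ℝ`). For a parameter `q = (v, w) ∈ ℝ² × ℝ²` put
`pert γ q θ = γ θ + cos θ • v + sin θ • w` (`Literature.Topology.FourManifolds.pert`), with velocity
`pertDeriv γ q θ = γ' θ - sin θ • v + cos θ • w`. Then for Lebesgue-almost every `q`
(`exists_pert_generic`, with `q` as small as desired):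

1. `pert γ q` is an immersion (`measure_setOf_pertDeriv_eq_zero`): the bad `q` solve the affine
   condition `-sin s • v + cos s • w = -γ' s` for some `s`, one real parameter against codimension
   two — the tree's `addHaar_setOf_exists_smul_add_smul_eq` (`NullImages.lean`, easy case of Sard's
   theorem, Milnor, *Topology from the differentiable viewpoint* (1965), §3).
2. every double point `pert γ q s = pert γ q t` (`s ≢ t mod 2π`) is transverse, i.e. the two
   velocities are linearly independent (`measure_pertBad₂_eq_zero`, `cross_pertDeriv_ne_zero`): the
   solution set `{(q, s, t) | pert γ q s = pert γ q t}` is the graph of `v` (where `cos s ≠ cos t`)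
   or of `w` (where `sin s ≠ sin t`) over the remaining variables, an explicit self-map
   `pertChart₁`/`pertChart₂` of `ℝ² × ℝ²`; implicit differentiation shows that a non-transverse
   double point is a critical point of that self-map, so the bad `q` are critical values and
   Mathlib's fixed-dimension Sard theorem `MeasureTheory.addHaar_image_eq_zero_of_det_fderivWithin_eq_zero`
   applies (Sard 1942; Milnor (1965), §3; this is the parametric transversality argument of
   Guillemin–Pollack (1974), Ch. 2 §3, in its simplest instance).
3. there are no triple points (`measure_pertBad₃_eq_zero`): three distinct points of the unit
   circle are affinely independent (`pertDet_ne_zero`: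
   `D = 4 sin((t-s)/2) sin((u-t)/2) sin((u-s)/2) ≠ 0`), so the four scalar conditions of a triple
   point determine `(v, w)` by Cramer's rule from the three parameters `(s, t, u)`: a differentiable
   image of `ℝ³` in `ℝ⁴` is null (`addHaar_image_eq_zero_of_finrank_lt`).

## References

* A. Sard, *The measure of the critical values of differentiable maps*, Bull. AMS 48 (1942).
  [Sard1942]
* J. Milnor, *Topology from the differentiable viewpoint* (1965), §§2–3. [MilnorTDV1965]
* V. Guillemin, A. Pollack, *Differential topology* (1974), Ch. 2 §3 (transversality theorem).
  [GuilleminPollack2010]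
* P. R. Cromwell, *Knots and Links* (2004), Thm. 3.2.1. [Cromwell2004]

## Design notes

"Same point of the circle" is written `cos s = cos t ∧ sin s = sin t` to keep this file free of
the sphere API; `GaussDiagramsReadOff.lean` translates to `circlePoint`. The `2 × 2` determinant
is the explicit `cross u₁ u₂ = u₁.1 u₂.2 - u₁.2 u₂.1` (`= Matrix.det !![u₁.1, u₁.2; u₂.1, u₂.2]`,
`Matrix.det_fin_two_of`). No statement of another file is modified; no `sorry`.
-/

open Set Function Module
open _root_.MeasureTheory _root_.MeasureTheory.Measure
open scoped Topology ContDiff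

noncomputable section

namespace Literature.Topology.FourManifolds

/-! ### The perturbation family -/

/-- The **first-harmonic perturbation** of a plane curve: `pert γ (v, w) θ = γ θ + cos θ • v + sin θ • w`.
[folklore] -/
def pert (γ : ℝ → ℝ × ℝ) (q : (ℝ × ℝ) × (ℝ × ℝ)) (θ : ℝ) : ℝ × ℝ :=
  γ θ + Real.cos θ • q.1 + Real.sin θ • q.2

/-- The velocity of the perturbed curve: `γ' θ - sin θ • v + cos θ • w`. [folklore] -/
def pertDeriv (γ : ℝ → ℝ × ℝ) (q : (ℝ × ℝ) × (ℝ × ℝ)) (θ : ℝ) : ℝ × ℝ :=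
  deriv γ θ + (-Real.sin θ) • q.1 + Real.cos θ • q.2

/-- The `2 × 2` determinant of two plane vectors. [folklore] -/
def cross (u₁ u₂ : ℝ × ℝ) : ℝ :=
  u₁.1 * u₂.2 - u₁.2 * u₂.1

variable {γ : ℝ → ℝ × ℝ}

/-- Unfolding of `pert`. [folklore] -/
theorem pert_apply (q : (ℝ × ℝ) × (ℝ × ℝ)) (θ : ℝ) :
    pert γ q θ = γ θ + Real.cos θ • q.1 + Real.sin θ • q.2 := rfl

/-- Unfolding of `pertDeriv`. [folklore] -/
theorem pertDeriv_apply (q : (ℝ × ℝ) × (ℝ × ℝ)) (θ : ℝ) :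
    pertDeriv γ q θ = deriv γ θ + (-Real.sin θ) • q.1 + Real.cos θ • q.2 := rfl

/-- The unperturbed curve: `pert γ 0 = γ`. [folklore] -/
@[simp] theorem pert_zero : pert γ 0 = γ := by
  funext θ; simp [pert]

/-- **The velocity of the perturbed curve.** [folklore] -/
theorem hasDerivAt_pert (hγ : Differentiable ℝ γ) (q : (ℝ × ℝ) × (ℝ × ℝ)) (θ : ℝ) :
    HasDerivAt (pert γ q) (pertDeriv γ q θ) θ := by
  unfold pert pertDeriv
  exact (((hγ θ).hasDerivAt).add ((Real.hasDerivAt_cos θ).smul_const q.1)).add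
    ((Real.hasDerivAt_sin θ).smul_const q.2)

/-- The derivative of the perturbed curve. [folklore] -/
theorem deriv_pert (hγ : Differentiable ℝ γ) (q : (ℝ × ℝ) × (ℝ × ℝ)) (θ : ℝ) :
    deriv (pert γ q) θ = pertDeriv γ q θ :=
  (hasDerivAt_pert hγ q θ).deriv

/-- The perturbed curve is differentiable. [folklore] -/
theorem differentiable_pert (hγ : Differentiable ℝ γ) (q : (ℝ × ℝ) × (ℝ × ℝ)) :
    Differentiable ℝ (pert γ q) := fun θ ↦ (hasDerivAt_pert hγ q θ).differentiableAt

/-- The perturbed curve is `C^n` when `γ` is. [folklore] -/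
theorem contDiff_pert {n : WithTop ℕ∞} (hγ : ContDiff ℝ n γ) (q : (ℝ × ℝ) × (ℝ × ℝ)) :
    ContDiff ℝ n (pert γ q) := by
  unfold pert
  exact (hγ.add (Real.contDiff_cos.smul contDiff_const)).add (Real.contDiff_sin.smul contDiff_const)

/-- The perturbed curve is `2π`-periodic when `γ` is. [folklore] -/
theorem periodic_pert (hγ : Periodic γ (2 * Real.pi)) (q : (ℝ × ℝ) × (ℝ × ℝ)) :
    Periodic (pert γ q) (2 * Real.pi) := fun θ ↦ by
  simp only [pert, hγ θ, Real.cos_add_two_pi, Real.sin_add_two_pi]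

/-- The size of the perturbation: `‖pert γ q θ - γ θ‖ ≤ ‖v‖ + ‖w‖`. [folklore] -/
theorem norm_pert_sub_le (q : (ℝ × ℝ) × (ℝ × ℝ)) (θ : ℝ) :
    ‖pert γ q θ - γ θ‖ ≤ ‖q.1‖ + ‖q.2‖ := by
  rw [pert_apply, add_assoc, add_sub_cancel_left]
  refine (norm_add_le _ _).trans (add_le_add ?_ ?_)
  · rw [norm_smul, Real.norm_eq_abs]
    exact mul_le_of_le_one_left (norm_nonneg _) (Real.abs_cos_le_one θ)
  · rw [norm_smul, Real.norm_eq_abs]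
    exact mul_le_of_le_one_left (norm_nonneg _) (Real.abs_sin_le_one θ)

/-- The size of the perturbation of the velocity: `‖pertDeriv γ q θ - γ' θ‖ ≤ ‖v‖ + ‖w‖`.
[folklore] -/
theorem norm_pertDeriv_sub_le (q : (ℝ × ℝ) × (ℝ × ℝ)) (θ : ℝ) :
    ‖pertDeriv γ q θ - deriv γ θ‖ ≤ ‖q.1‖ + ‖q.2‖ := by
  rw [pertDeriv_apply, add_assoc, add_sub_cancel_left]
  refine (norm_add_le _ _).trans (add_le_add ?_ ?_)
  · rw [norm_smul, norm_neg, Real.norm_eq_abs]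
    exact mul_le_of_le_one_left (norm_nonneg _) (Real.abs_sin_le_one θ)
  · rw [norm_smul, Real.norm_eq_abs]
    exact mul_le_of_le_one_left (norm_nonneg _) (Real.abs_cos_le_one θ)

/-! ### Plane vectors: the determinant and linear dependence -/

/-- `cross` is Mathlib's `2 × 2` determinant. [folklore] -/
theorem cross_eq_det (u₁ u₂ : ℝ × ℝ) :
    cross u₁ u₂ = Matrix.det !![u₁.1, u₁.2; u₂.1, u₂.2] := by
  rw [Matrix.det_fin_two_of, cross]

/-- Two plane vectors with vanishing determinant are linearly dependent, with an explicit
nontrivial relation `a • u₁ = b • u₂`. [folklore] -/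
theorem exists_smul_eq_smul_of_cross_eq_zero {u₁ u₂ : ℝ × ℝ} (h : cross u₁ u₂ = 0) :
    ∃ ab : ℝ × ℝ, ab ≠ 0 ∧ ab.1 • u₁ = ab.2 • u₂ := by
  unfold cross at h
  by_cases h1 : ((u₂.2, u₁.2) : ℝ × ℝ) ≠ 0
  · refine ⟨(u₂.2, u₁.2), h1, Prod.ext ?_ ?_⟩
    · simp only [Prod.smul_fst, smul_eq_mul]; linarith
    · simp only [Prod.smul_snd, smul_eq_mul]; ring
  · push Not at h1
    simp only [Prod.mk_eq_zero] at h1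
    by_cases h2 : ((u₂.1, u₁.1) : ℝ × ℝ) ≠ 0
    · refine ⟨(u₂.1, u₁.1), h2, Prod.ext ?_ ?_⟩
      · simp only [Prod.smul_fst, smul_eq_mul]; ring
      · simp only [Prod.smul_snd, smul_eq_mul, h1.1, h1.2, mul_zero]
    · push Not at h2
      simp only [Prod.mk_eq_zero] at h2
      refine ⟨(1, 0), by simp, Prod.ext ?_ ?_⟩
      · simp [h2.2]
      · simp [h1.2]

/-! ### Immersion: the bad parameters are null -/

section Measure

variable (μ : Measure ((ℝ × ℝ) × (ℝ × ℝ))) [IsAddHaarMeasure μ]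

/-- **Almost every perturbation is an immersion**: the set of `q` for which `pertDeriv γ q`
vanishes somewhere is null (one real parameter `s`, affine condition of codimension two;
`addHaar_setOf_exists_smul_add_smul_eq`). Milnor (1965), §3 (easy case of Sard's theorem).
[cite: MilnorTDV1965, §3] -/
theorem measure_setOf_pertDeriv_eq_zero (hγ : ContDiff ℝ ∞ γ) :
    μ {q | ∃ s, pertDeriv γ q s = 0} = 0 := by
  have hd : Differentiable ℝ (deriv γ) :=
    (contDiff_infty_iff_deriv.1 hγ).2.differentiable (by simp)
  have hdim : finrank ℝ ℝ < finrank ℝ (ℝ × ℝ) := by simp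
  refine measure_mono_null ?_ (addHaar_setOf_exists_smul_add_smul_eq μ hdim (P := univ)
    (a := fun s ↦ -Real.sin s) (b := Real.cos) (Δ := fun s ↦ -deriv γ s)
    (Real.differentiable_sin.neg.differentiableOn) Real.differentiable_cos.differentiableOn
    hd.neg.differentiableOn)
  rintro q ⟨s, hs⟩
  refine ⟨s, mem_univ _, ?_, ?_⟩
  · show -Real.sin s ≠ 0 ∨ Real.cos s ≠ 0
    by_contra hnot
    push Not at hnot
    have := Real.sin_sq_add_cos_sq s
    rw [neg_eq_zero] at hnot
    rw [hnot.1, hnot.2] at this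
    norm_num at this
  · show -Real.sin s • q.1 + Real.cos s • q.2 = -deriv γ s
    rw [pertDeriv_apply] at hs
    rw [eq_neg_iff_add_eq_zero, ← hs]
    abel

/-! ### Triple points: the bad parameters are null -/

/-- The `2 × 2` determinant of the triple-point system: for points `s, t, u` of the circle,
`D = (cos s - cos u)(sin t - sin u) - (cos t - cos u)(sin s - sin u)`, twice the signed area of
the triangle with vertices `(cos, sin)` of `s, t, u`. [folklore] -/
def pertDet (p : ℝ × ℝ × ℝ) : ℝ :=
  (Real.cos p.1 - Real.cos p.2.2) * (Real.sin p.2.1 - Real.sin p.2.2) -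
    (Real.cos p.2.1 - Real.cos p.2.2) * (Real.sin p.1 - Real.sin p.2.2)

/-- **Three distinct points of the unit circle are not collinear**:
`D = 4 sin((t-s)/2) sin((u-t)/2) sin((u-s)/2)`. [folklore] -/
theorem pertDet_eq (s t u : ℝ) :
    pertDet (s, t, u) = 4 * Real.sin ((t - s) / 2) * Real.sin ((u - t) / 2) *
      Real.sin ((u - s) / 2) := by
  have hD : pertDet (s, t, u) = Real.sin (t - s) + Real.sin (u - t) + Real.sin (s - u) := by
    simp only [pertDet, Real.sin_sub]
    ring
  set a := (t - s) / 2 with ha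
  set b := (u - t) / 2 with hb
  have h1 : t - s = 2 * a := by rw [ha]; ring
  have h2 : u - t = 2 * b := by rw [hb]; ring
  have h3 : s - u = -(2 * (a + b)) := by rw [ha, hb]; ring
  have h4 : (u - s) / 2 = a + b := by rw [ha, hb]; ring
  rw [hD, h1, h2, h3, h4, Real.sin_neg, Real.sin_two_mul, Real.sin_two_mul, Real.sin_two_mul,
    Real.sin_add, Real.cos_add]
  have ha' := Real.sin_sq_add_cos_sq a
  have hb' := Real.sin_sq_add_cos_sq b
  linear_combination (-2 * Real.sin a * Real.cos a) * hb' + (-2 * Real.sin b * Real.cos b) * ha'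

/-- Parameters differing by a multiple of `2π` define the same point of the circle. [folklore] -/
theorem cos_eq_and_sin_eq_of_sin_half_eq_zero {s t : ℝ} (h : Real.sin ((t - s) / 2) = 0) :
    Real.cos s = Real.cos t ∧ Real.sin s = Real.sin t := by
  obtain ⟨k, hk⟩ := Real.sin_eq_zero_iff.1 h
  have ht : t = s + k * (2 * Real.pi) := by linarith
  refine ⟨?_, ?_⟩
  · rw [ht, Real.cos_add_int_mul_two_pi]
  · rw [ht, Real.sin_add_int_mul_two_pi]

/-- The determinant of the triple-point system is nonzero for pairwise distinct points of the
circle. [folklore] -/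
theorem pertDet_ne_zero {s t u : ℝ} (hst : ¬ (Real.cos s = Real.cos t ∧ Real.sin s = Real.sin t))
    (htu : ¬ (Real.cos t = Real.cos u ∧ Real.sin t = Real.sin u))
    (hsu : ¬ (Real.cos s = Real.cos u ∧ Real.sin s = Real.sin u)) : pertDet (s, t, u) ≠ 0 := by
  rw [pertDet_eq]
  refine mul_ne_zero (mul_ne_zero (mul_ne_zero four_ne_zero ?_) ?_) ?_
  · exact fun h ↦ hst (cos_eq_and_sin_eq_of_sin_half_eq_zero h)
  · exact fun h ↦ htu (cos_eq_and_sin_eq_of_sin_half_eq_zero h)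
  · exact fun h ↦ hsu (cos_eq_and_sin_eq_of_sin_half_eq_zero h)

/-- **Cramer's rule for the triple-point system**: the parameters `(v, w)` of a triple point
`pert s = pert u`, `pert t = pert u` as a function of `(s, t, u)`. [folklore] -/
def pertTripleParam (γ : ℝ → ℝ × ℝ) (p : ℝ × ℝ × ℝ) : (ℝ × ℝ) × (ℝ × ℝ) :=
  ((pertDet p)⁻¹ • ((Real.sin p.2.1 - Real.sin p.2.2) • (-(γ p.1 - γ p.2.2)) -
      (Real.sin p.1 - Real.sin p.2.2) • (-(γ p.2.1 - γ p.2.2))),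
    (pertDet p)⁻¹ • ((Real.cos p.1 - Real.cos p.2.2) • (-(γ p.2.1 - γ p.2.2)) -
      (Real.cos p.2.1 - Real.cos p.2.2) • (-(γ p.1 - γ p.2.2))))

/-- `pertDet` is differentiable. [folklore] -/
theorem differentiable_pertDet : Differentiable ℝ pertDet := by
  unfold pertDet
  fun_prop

/-- The Cramer parametrisation is differentiable where the determinant is nonzero. [folklore] -/
theorem differentiableOn_pertTripleParam (hγ : Differentiable ℝ γ) :
    DifferentiableOn ℝ (pertTripleParam γ) {p | pertDet p ≠ 0} := by
  have hinv : DifferentiableOn ℝ (fun p ↦ (pertDet p)⁻¹) {p | pertDet p ≠ 0} :=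
    DifferentiableOn.inv differentiable_pertDet.differentiableOn fun p hp ↦ hp
  have h1 : Differentiable ℝ fun p : ℝ × ℝ × ℝ ↦ γ p.1 := hγ.comp differentiable_fst
  have h2 : Differentiable ℝ fun p : ℝ × ℝ × ℝ ↦ γ p.2.1 :=
    hγ.comp (differentiable_fst.comp differentiable_snd)
  have h3 : Differentiable ℝ fun p : ℝ × ℝ × ℝ ↦ γ p.2.2 :=
    hγ.comp (differentiable_snd.comp differentiable_snd)
  unfold pertTripleParam
  refine DifferentiableOn.prodMk (hinv.smul (Differentiable.differentiableOn ?_))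
    (hinv.smul (Differentiable.differentiableOn ?_)) <;> fun_prop

/-- **Uniqueness in Cramer's rule**: a solution `(v, w)` of the triple-point system with nonzero
determinant is `pertTripleParam γ (s, t, u)`. [folklore] -/
theorem eq_pertTripleParam {q : (ℝ × ℝ) × (ℝ × ℝ)} {s t u : ℝ} (hD : pertDet (s, t, u) ≠ 0)
    (h1 : (Real.cos s - Real.cos u) • q.1 + (Real.sin s - Real.sin u) • q.2 = -(γ s - γ u))
    (h2 : (Real.cos t - Real.cos u) • q.1 + (Real.sin t - Real.sin u) • q.2 = -(γ t - γ u)) :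
    q = pertTripleParam γ (s, t, u) := by
  -- eliminate `w`, then `v`
  have hv : pertDet (s, t, u) • q.1 = (Real.sin t - Real.sin u) • (-(γ s - γ u)) -
      (Real.sin s - Real.sin u) • (-(γ t - γ u)) := by
    rw [← h1, ← h2, pertDet]
    simp only [smul_add, smul_smul]
    module
  have hw : pertDet (s, t, u) • q.2 = (Real.cos s - Real.cos u) • (-(γ t - γ u)) -
      (Real.cos t - Real.cos u) • (-(γ s - γ u)) := by
    rw [← h1, ← h2, pertDet]
    simp only [smul_add, smul_smul]
    module
  refine Prod.ext ?_ ?_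
  · show q.1 = (pertDet (s, t, u))⁻¹ • _
    rw [← hv, smul_smul, inv_mul_cancel₀ hD, one_smul]
  · show q.2 = (pertDet (s, t, u))⁻¹ • _
    rw [← hw, smul_smul, inv_mul_cancel₀ hD, one_smul]

/-- The set of parameters with a **triple point**: pairwise distinct points `s, t, u` of the circle
with `pert s = pert u` and `pert t = pert u`. [folklore] -/
def pertBad₃ (γ : ℝ → ℝ × ℝ) : Set ((ℝ × ℝ) × (ℝ × ℝ)) :=
  {q | ∃ s t u, ¬ (Real.cos s = Real.cos t ∧ Real.sin s = Real.sin t) ∧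
    ¬ (Real.cos t = Real.cos u ∧ Real.sin t = Real.sin u) ∧
    ¬ (Real.cos s = Real.cos u ∧ Real.sin s = Real.sin u) ∧
    pert γ q s = pert γ q u ∧ pert γ q t = pert γ q u}

/-- **Almost every perturbation has no triple points**: the parameters with a triple point form
the image of a differentiable map from `ℝ³` to `ℝ⁴`, a null set
(`addHaar_image_eq_zero_of_finrank_lt`). Milnor (1965), §3. [cite: MilnorTDV1965, §3] -/
theorem measure_pertBad₃_eq_zero (hγ : Differentiable ℝ γ) : μ (pertBad₃ γ) = 0 := by
  have hdim : finrank ℝ (ℝ × ℝ × ℝ) < finrank ℝ ((ℝ × ℝ) × (ℝ × ℝ)) := by simp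
  refine measure_mono_null ?_ (addHaar_image_eq_zero_of_finrank_lt μ hdim
    (differentiableOn_pertTripleParam hγ))
  rintro q ⟨s, t, u, hst, htu, hsu, h1, h2⟩
  have hD := pertDet_ne_zero hst htu hsu
  refine ⟨(s, t, u), hD, (eq_pertTripleParam hD ?_ ?_).symm⟩
  · rw [pert_apply, pert_apply] at h1
    rw [sub_smul, sub_smul]
    linear_combination (norm := module) h1
  · rw [pert_apply, pert_apply] at h2
    rw [sub_smul, sub_smul]
    linear_combination (norm := module) h2

end Measure

end Literature.Topology.FourManifolds
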